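import Summits.NavierStokesRegularity.NavierStokesRegularity.Theorems.SymmetryModuliCountForcedSymmetryStubSatelliteExclusionOfStripIntegrable
import HarnessLib

/-!
# Crux `ForcedSymmetry` (stmt-NavierStokesRegularity-4052), line `recurrent-closing`, stub 3a
# `stub_satelliteExclusion`: the stub IS a strip-integrability statement

Support file (theorems only, `--supports stmt-NavierStokesRegularity-4052`; the same stub is stub 1 of crux stmt-8561's line
`birth`).  Lead c6, 2026-08-17.  Corollaries of the in-class Chae–Wolf satellite criterion
(`…StubSatelliteExclusionOfStripIntegrable`):

* `lintegral_strip_rpow_le_of_hasTypeITimeDecay` — under the Type-I time rate `‖w‖ ≤ C/√(−t)` the field is bounded by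
  `max C 1` on a period strip `t ≤ −1`, so finiteness of `∫∫_{strip} ‖w‖^p` is MONOTONE in `p`: any `0 < p < 9` may be
  raised into `(3, 9)`;
* `satelliteExclusion_of_stripIntegrable_of_pos` — hence satellite exclusion from ANY finite `L^p` norm on one period strip,
  `0 < p < 9`; in particular from finite kinetic ENERGY on one period strip (`p = 2`), or `p = 3`;
* `stub_satelliteExclusion_iff_stripIntegrability` — the registered signature of `stub_satelliteExclusion` (written out) is
  EQUIVALENT to: every smooth RDSS profile of `𝒦_C` has `∫∫_{(−l²,−1] × ℝ³} ‖w‖⁴ < ∞`.  This is the certificate of what the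
  open stub says: Type-I RDSS profiles are `L⁴`-thin on one period strip (⇔ satellite-free ⇔ space–time Type-I decay).

References: D. Chae, J. Wolf, Comm. PDE 42 (2017) = arXiv:1610.09464, Thm 1.1 [ChaeWolf2017RemovingDSS]; D. Albritton,
T. Barker, JMFM 21 (2019), §3 [AlbrittonBarker2019].
-/

noncomputable section

-- the summit and its single sub-problem share the name (CONVENTIONS §1), as in every Theorems file
set_option linter.dupNamespace false

open MeasureTheory Set Function Metric Filter Topology
open scoped ENNReal NNReal
open Literature.Analysis.FluidPDE

namespace Summit.NavierStokesRegularity.NavierStokesRegularity.Theorems.SymmetryModuliCountForcedSymmetry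

/-! ### Under the Type-I time rate, strip integrability is monotone in the exponent -/

/-- **On a period strip the time rate bounds the field**: `HasTypeITimeDecay C w` gives `‖w(t,x)‖ ≤ max C 1` for
`t ≤ −1` (`√(−t) ≥ 1`). [folklore] -/
theorem norm_le_of_hasTypeITimeDecay_of_le_neg_one {w : ℝ → EuclideanSpace ℝ (Fin 3) → EuclideanSpace ℝ (Fin 3)}
    {C : ℝ} (hdec : HasTypeITimeDecay C w) {t : ℝ} (ht : t ≤ -1) (x : EuclideanSpace ℝ (Fin 3)) :
    ‖w t x‖ ≤ max C 1 := by
  have ht0 : t < 0 := by linarith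
  have h1 : 1 ≤ Real.sqrt (-t) := by
    rw [show (1 : ℝ) = Real.sqrt 1 by simp]
    exact Real.sqrt_le_sqrt (by linarith)
  have h := hdec t ht0 x
  rcases le_or_gt 0 C with hC | hC
  · calc ‖w t x‖ ≤ C / Real.sqrt (-t) := h
      _ ≤ C / 1 := div_le_div_of_nonneg_left hC one_pos h1
      _ ≤ max C 1 := by rw [div_one]; exact le_max_left _ _
  · have : C / Real.sqrt (-t) < 0 := div_neg_of_neg_of_pos hC (by linarith)
    linarith [norm_nonneg (w t x), le_max_right C 1]

/-- **Raising the exponent on a period strip.**  Under the time rate, for `0 < p ≤ p'` and a strip `(a, −1] × ℝ³`: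
`∫∫ ‖w‖^{p'} ≤ (max C 1)^{p'−p} ∫∫ ‖w‖^p`. [folklore] -/
theorem lintegral_strip_rpow_le_of_hasTypeITimeDecay {w : ℝ → EuclideanSpace ℝ (Fin 3) → EuclideanSpace ℝ (Fin 3)}
    {C : ℝ} (hdec : HasTypeITimeDecay C w) {p p' : ℝ} (hp : 0 < p) (hpp' : p ≤ p') (a : ℝ) :
    ∫⁻ z in Ioc a (-1) ×ˢ (univ : Set (EuclideanSpace ℝ (Fin 3))), ‖w z.1 z.2‖ₑ ^ p' ≤
      ENNReal.ofReal ((max C 1) ^ (p' - p)) *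
        ∫⁻ z in Ioc a (-1) ×ˢ (univ : Set (EuclideanSpace ℝ (Fin 3))), ‖w z.1 z.2‖ₑ ^ p := by
  set M : ℝ := max C 1 with hM
  have hM1 : 1 ≤ M := le_max_right _ _
  have hM0 : 0 < M := one_pos.trans_le hM1
  rw [← lintegral_const_mul' _ _ ENNReal.ofReal_ne_top]
  refine lintegral_mono_ae ((ae_restrict_mem (measurableSet_Ioc.prod MeasurableSet.univ)).mono ?_)
  rintro ⟨t, x⟩ ⟨ht, -⟩
  have hb : ‖w t x‖ ≤ M := norm_le_of_hasTypeITimeDecay_of_le_neg_one hdec ht.2 x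
  show ‖w t x‖ₑ ^ p' ≤ ENNReal.ofReal (M ^ (p' - p)) * ‖w t x‖ₑ ^ p
  rw [← ofReal_norm, ENNReal.ofReal_rpow_of_nonneg (norm_nonneg _) (by linarith),
    ENNReal.ofReal_rpow_of_nonneg (norm_nonneg _) hp.le, ← ENNReal.ofReal_mul (Real.rpow_nonneg hM0.le _)]
  refine ENNReal.ofReal_le_ofReal ?_
  have hn : 0 ≤ ‖w t x‖ := norm_nonneg _
  calc ‖w t x‖ ^ p' = ‖w t x‖ ^ (p' - p) * ‖w t x‖ ^ p := by
        rw [← Real.rpow_add' hn (by linarith)]; ring_nf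
    _ ≤ M ^ (p' - p) * ‖w t x‖ ^ p :=
        mul_le_mul_of_nonneg_right (Real.rpow_le_rpow hn hb (by linarith)) (Real.rpow_nonneg hn _)

/-- **Satellite exclusion from ANY finite `L^p` norm on the period strip, `0 < p < 9`** — in particular from FINITE
KINETIC ENERGY on one period strip (`p = 2`) or from `p = 3`: under the time rate the exponent may be raised into `(3, 9)`
(`lintegral_strip_rpow_le_of_hasTypeITimeDecay`), then `satelliteExclusion_of_stripIntegrable` applies.  Same binders as
the registered stub, plus `0 < p < 9` and the finiteness. [cite: ChaeWolf2017RemovingDSS, Thm 1.1 (arXiv p. 3)] -/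
theorem satelliteExclusion_of_stripIntegrable_of_pos :
    ∀ (w : ℝ → EuclideanSpace ℝ (Fin 3) → EuclideanSpace ℝ (Fin 3)) (q : ℝ → EuclideanSpace ℝ (Fin 3) → ℝ)
      (H : ℝ → EuclideanSpace ℝ (Fin 3) → EuclideanSpace ℝ (Fin 3) →L[ℝ] EuclideanSpace ℝ (Fin 3)) (C : ℝ),
      IsSuitableWeakSolutionOn (slab (EuclideanSpace ℝ (Fin 3)) (Set.Iio 0) isOpen_Iio) 1 0 w q →
      HasWeakSpatialGradientOn (slab (EuclideanSpace ℝ (Fin 3)) (Set.Iio 0) isOpen_Iio) w H →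
      typeIBound (Set.Iio (0 : ℝ) ×ˢ Set.univ) w q H < ⊤ →
      HasTypeITimeDecay C w →
      IsClassicalNSSolutionOn (Set.Iio 0) 1 0 w q →
      ∀ (l : ℝ) (R : EuclideanSpace ℝ (Fin 3) ≃ₗᵢ[ℝ] EuclideanSpace ℝ (Fin 3)) (ξ : EuclideanSpace ℝ (Fin 3)), 1 < l →
        (fun z : ℝ × EuclideanSpace ℝ (Fin 3) => l • R.symm (w (l ^ 2 * z.1) (l • R z.2 + ξ)))
          =ᵐ[volume.restrict (Set.Iio (0 : ℝ) ×ˢ Set.univ)] (fun z : ℝ × EuclideanSpace ℝ (Fin 3) => w z.1 z.2) →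
        ∀ p : ℝ, 0 < p → p < 9 →
          ∫⁻ z in Set.Ioc (-l ^ 2) (-1) ×ˢ (Set.univ : Set (EuclideanSpace ℝ (Fin 3))), ‖w z.1 z.2‖ₑ ^ p < ⊤ →
        ∀ y : EuclideanSpace ℝ (Fin 3), y ≠ l • R y + ξ → ¬ IsBackwardSingularPoint w ((0 : ℝ), y) := by
  intro w q H C hsw hwg hI hdec hcl l R ξ hl hae p hp0 hp9 hfin
  -- an exponent in `(3, 9)` above `p`
  set p' : ℝ := max p 4 with hp'
  have hp'3 : 3 < p' := lt_of_lt_of_le (by norm_num) (le_max_right _ _)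
  have hp'9 : p' < 9 := max_lt hp9 (by norm_num)
  have hfin' : ∫⁻ z in Set.Ioc (-l ^ 2) (-1) ×ˢ (Set.univ : Set (EuclideanSpace ℝ (Fin 3))), ‖w z.1 z.2‖ₑ ^ p' < ⊤ :=
    lt_of_le_of_lt (lintegral_strip_rpow_le_of_hasTypeITimeDecay hdec hp0 (le_max_left _ _) _)
      (ENNReal.mul_lt_top ENNReal.ofReal_lt_top hfin)
  exact satelliteExclusion_of_stripIntegrable w q H C hsw hwg hI hdec hcl l R ξ hl hae p' hp'3 hp'9 hfin'

/-! ### The registered stub IS a strip-integrability statement -/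

/-- **`stub_satelliteExclusion` ⇔ "every RDSS profile of the class has finite `L⁴` norm on one period strip".**  The
registered signature of the stub (written out; left side) is equivalent to the statement that every smooth profile of
`𝒦_C` which is RDSS a.e. on the slab (any `l > 1`, `R`, `ξ`) satisfies `∫∫_{(−l²,−1] × ℝ³} ‖w‖⁴ < ∞` (right side).
(⇐) is `satelliteExclusion_of_stripIntegrable` with `p = 4`.  (⇒): translate the centre to the origin (the class, the time
rate, classical solutions and the a.e. clause are translation covariant); the stub makes the translated profile
satellite-free, Chae–Wolf's scaling step (`stub_decayOfSatelliteFree`, p142689) gives space–time Type-I decay, decay gives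
finiteness for every exponent `> 3` (`lintegral_strip_lt_top_of_hasTypeIDecay`), and the strip integral is translation
invariant (`lintegral_strip_translate`).  (Finite ENERGY on a strip, `p = 2`, is sufficient —
`satelliteExclusion_of_stripIntegrable_of_pos` — but not necessary: a satellite-free nonzero profile has a `1/|x|` far field.)
[cite: ChaeWolf2017RemovingDSS, Thm 1.1 with (1.5) (arXiv p. 3); AlbrittonBarker2019, §3] -/
theorem stub_satelliteExclusion_iff_stripIntegrability :
    (∀ (w : ℝ → EuclideanSpace ℝ (Fin 3) → EuclideanSpace ℝ (Fin 3)) (q : ℝ → EuclideanSpace ℝ (Fin 3) → ℝ)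
      (H : ℝ → EuclideanSpace ℝ (Fin 3) → EuclideanSpace ℝ (Fin 3) →L[ℝ] EuclideanSpace ℝ (Fin 3)) (C : ℝ),
      IsSuitableWeakSolutionOn (slab (EuclideanSpace ℝ (Fin 3)) (Set.Iio 0) isOpen_Iio) 1 0 w q →
      HasWeakSpatialGradientOn (slab (EuclideanSpace ℝ (Fin 3)) (Set.Iio 0) isOpen_Iio) w H →
      typeIBound (Set.Iio (0 : ℝ) ×ˢ Set.univ) w q H < ⊤ →
      HasTypeITimeDecay C w →
      IsClassicalNSSolutionOn (Set.Iio 0) 1 0 w q →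
      ∀ (l : ℝ) (R : EuclideanSpace ℝ (Fin 3) ≃ₗᵢ[ℝ] EuclideanSpace ℝ (Fin 3)) (ξ : EuclideanSpace ℝ (Fin 3)), 1 < l →
        (fun z : ℝ × EuclideanSpace ℝ (Fin 3) => l • R.symm (w (l ^ 2 * z.1) (l • R z.2 + ξ)))
          =ᵐ[volume.restrict (Set.Iio (0 : ℝ) ×ˢ Set.univ)] (fun z : ℝ × EuclideanSpace ℝ (Fin 3) => w z.1 z.2) →
        ∀ y : EuclideanSpace ℝ (Fin 3), y ≠ l • R y + ξ → ¬ IsBackwardSingularPoint w ((0 : ℝ), y)) ↔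
    (∀ (w : ℝ → EuclideanSpace ℝ (Fin 3) → EuclideanSpace ℝ (Fin 3)) (q : ℝ → EuclideanSpace ℝ (Fin 3) → ℝ)
      (H : ℝ → EuclideanSpace ℝ (Fin 3) → EuclideanSpace ℝ (Fin 3) →L[ℝ] EuclideanSpace ℝ (Fin 3)) (C : ℝ),
      IsSuitableWeakSolutionOn (slab (EuclideanSpace ℝ (Fin 3)) (Set.Iio 0) isOpen_Iio) 1 0 w q →
      HasWeakSpatialGradientOn (slab (EuclideanSpace ℝ (Fin 3)) (Set.Iio 0) isOpen_Iio) w H →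
      typeIBound (Set.Iio (0 : ℝ) ×ˢ Set.univ) w q H < ⊤ →
      HasTypeITimeDecay C w →
      IsClassicalNSSolutionOn (Set.Iio 0) 1 0 w q →
      ∀ (l : ℝ) (R : EuclideanSpace ℝ (Fin 3) ≃ₗᵢ[ℝ] EuclideanSpace ℝ (Fin 3)) (ξ : EuclideanSpace ℝ (Fin 3)), 1 < l →
        (fun z : ℝ × EuclideanSpace ℝ (Fin 3) => l • R.symm (w (l ^ 2 * z.1) (l • R z.2 + ξ)))
          =ᵐ[volume.restrict (Set.Iio (0 : ℝ) ×ˢ Set.univ)] (fun z : ℝ × EuclideanSpace ℝ (Fin 3) => w z.1 z.2) →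
        ∫⁻ z in Set.Ioc (-l ^ 2) (-1) ×ˢ (Set.univ : Set (EuclideanSpace ℝ (Fin 3))), ‖w z.1 z.2‖ₑ ^ (4 : ℝ) < ⊤) := by
  constructor
  · -- (⇒): translate, satellite-free, decay, integrate
    intro hstub w q H C hsw hwg hI hdec hcl l R ξ hl hae
    have hl0 : 0 < l := one_pos.trans hl
    have hae' : (fun z : ℝ × EuclideanSpace ℝ (Fin 3) => l • R.symm (w (l ^ 2 * z.1 + 0) (l • R z.2 + ξ)))
        =ᵐ[volume.restrict (Iio (0 : ℝ) ×ˢ (univ : Set (EuclideanSpace ℝ (Fin 3))))]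
        (fun z : ℝ × EuclideanSpace ℝ (Fin 3) => w z.1 z.2) := by
      simpa only [add_zero] using hae
    have hinvξ : ∀ t < (0 : ℝ), ∀ x : EuclideanSpace ℝ (Fin 3), l • R.symm (w (l ^ 2 * t) (l • R x + ξ)) = w t x := by
      intro t ht x
      simpa only [add_zero] using rdssInvariant_pointwise_of_classical R ξ hcl hl0 le_rfl hae' t ht x
    obtain ⟨c, hc, -⟩ := exists_unique_rdssCentre hl R ξ
    -- the translated profile
    set w₁ : ℝ → EuclideanSpace ℝ (Fin 3) → EuclideanSpace ℝ (Fin 3) := (1 : ℝ) • stPull ((1 : ℝ) ^ 2) 1 0 c w with hw₁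
    set q₁ : ℝ → EuclideanSpace ℝ (Fin 3) → ℝ := (1 : ℝ) ^ 2 • stPull ((1 : ℝ) ^ 2) 1 0 c q with hq₁
    set H₁ : ℝ → EuclideanSpace ℝ (Fin 3) → EuclideanSpace ℝ (Fin 3) →L[ℝ] EuclideanSpace ℝ (Fin 3) :=
      (1 : ℝ) ^ 2 • stPull ((1 : ℝ) ^ 2) 1 0 c H with hH₁
    have hw₁_apply : ∀ t x, w₁ t x = w t (c + x) := fun t x => by
      simp only [hw₁, stPull_apply, one_smul, one_pow, one_mul, zero_add]
    have hsw₁ : IsSuitableWeakSolutionOn (slab (EuclideanSpace ℝ (Fin 3)) (Iio (0 : ℝ)) isOpen_Iio) 1 0 w₁ q₁ := by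
      have h := zoom_isSuitableWeakSolutionOn hsw one_pos 0 c
      rwa [stPreimage_one_slab_eq c] at h
    have hwg₁ : HasWeakSpatialGradientOn (slab (EuclideanSpace ℝ (Fin 3)) (Iio (0 : ℝ)) isOpen_Iio) w₁ H₁ := by
      have h := zoom_hasWeakSpatialGradientOn hwg one_pos 0 c
      rwa [stPreimage_one_slab_eq c] at h
    have hI₁ : typeIBound (Iio (0 : ℝ) ×ˢ (univ : Set (EuclideanSpace ℝ (Fin 3)))) w₁ q₁ H₁ < ⊤ := by
      have h := typeIBound_nsZoom one_pos 0 c (Iio (0 : ℝ) ×ˢ (univ : Set (EuclideanSpace ℝ (Fin 3)))) w q H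
      rw [stAffine_one_preimage_lowerHalf' c] at h
      rw [hw₁, hq₁, hH₁, h]
      exact hI
    have hdec₁ : HasTypeITimeDecay C w₁ := fun t ht x => by rw [hw₁_apply]; exact hdec t ht (c + x)
    have hcl₁ : IsClassicalNSSolutionOn (Iio 0) 1 0 w₁ q₁ := by
      have h := hcl.nsRescale_translate_zero one_pos 0 c
      have e : (fun r : ℝ => (0 : ℝ) + (1 : ℝ) ^ 2 * r) ⁻¹' Iio (0 : ℝ) = Iio 0 := by
        ext r; simp
      rwa [e] at h
    have hinv₁ : ∀ t < (0 : ℝ), ∀ x : EuclideanSpace ℝ (Fin 3), l • R.symm (w₁ (l ^ 2 * t) (l • R x)) = w₁ t x := by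
      intro t ht x
      rw [hw₁_apply, hw₁_apply]
      have e : c + l • R x = l • R (c + x) + ξ := by
        conv_lhs => rw [hc]
        rw [map_add, smul_add]
        abel
      rw [e]
      exact hinvξ t ht (c + x)
    have hae₁ : (fun z : ℝ × EuclideanSpace ℝ (Fin 3) => l • R.symm (w₁ (l ^ 2 * z.1) (l • R z.2 + 0)))
        =ᵐ[volume.restrict (Iio (0 : ℝ) ×ˢ (univ : Set (EuclideanSpace ℝ (Fin 3))))]
        (fun z : ℝ × EuclideanSpace ℝ (Fin 3) => w₁ z.1 z.2) := by
      filter_upwards [ae_restrict_mem (measurableSet_Iio.prod MeasurableSet.univ)] with z hz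
      rw [add_zero]
      exact hinv₁ z.1 hz.1 z.2
    have hae₁' : (fun z : ℝ × EuclideanSpace ℝ (Fin 3) => l • R.symm (w₁ (l ^ 2 * z.1) (l • R z.2)))
        =ᵐ[volume.restrict (Iio (0 : ℝ) ×ˢ (univ : Set (EuclideanSpace ℝ (Fin 3))))]
        (fun z : ℝ × EuclideanSpace ℝ (Fin 3) => w₁ z.1 z.2) := by
      simpa only [add_zero] using hae₁
    -- satellite-free by the stub, decay by the scaling step, integrability
    have hsat₁ : ∀ y : EuclideanSpace ℝ (Fin 3), y ≠ l • R y → ¬ IsBackwardSingularPoint w₁ ((0 : ℝ), y) :=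
      fun y hy => hstub w₁ q₁ H₁ C hsw₁ hwg₁ hI₁ hdec₁ hcl₁ l R 0 hl hae₁ y (by simpa only [add_zero] using hy)
    obtain ⟨C₀, hC₀⟩ := stub_decayOfSatelliteFree w₁ q₁ C hdec₁ hcl₁ l R hl hae₁' hsat₁
    have hfin₁ := lintegral_strip_lt_top_of_hasTypeIDecay hC₀ (p := 4) (by norm_num) (a := -l ^ 2) (b := -1) (by norm_num)
    rw [hw₁, lintegral_strip_translate w c _ 4] at hfin₁
    exact hfin₁
  · -- (⇐): the criterion with `p = 4`
    intro hint w q H C hsw hwg hI hdec hcl l R ξ hl hae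
    exact satelliteExclusion_of_stripIntegrable w q H C hsw hwg hI hdec hcl l R ξ hl hae 4 (by norm_num) (by norm_num)
      (hint w q H C hsw hwg hI hdec hcl l R ξ hl hae)

end Summit.NavierStokesRegularity.NavierStokesRegularity.Theorems.SymmetryModuliCountForcedSymmetry

end
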